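import Summits.ResolutionOfSingularities.ResolutionOfSingularities.Theorems.PurelyInseparableDim4EquimultiplePoints
import HarnessLib

/-!
# Purely inseparable four-folds: every point of the transform over the centre lies in an `x_j`-chart, `j ∈ S`;
# the closed order-`p` points of the controlled transform over `V(z, x_S)` (brick TY-3e «POINTS», part 2)

[OURS · counted 0] (cell `res-dim4-pi`, D-0157 DOOR 2; continues `…EquimultiplePoints.lean` (part 1, the `z`-chart)
and `…EquimultipleChart.lean` (TY-3c); host item stmt-ResolutionOfSingularities-16155, helper). Nothing here proves
resolution of singularities in dimension ≥ 4 / characteristic `p`.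

* §1 `chartImm_zero_mem_chart_succ` — CHART OVERLAP: a point of the `z`-chart of a blowing up `π : W → 𝔸⁵_K` along
  `V(z, x_S)` at which `xⱼ` (`j ∈ S`) is not in the prime lies in the principal chart `W[⊤, x_j]` (on the basic open
  `D(x′ⱼ)` of the `z`-chart, `π^*x_j = z′·x′ⱼ` is a nonzerodivisor generating the exceptional ideal `(z′)` —
  tree `mem_blowupChart_iff` / `IsPrincipalChart`);
* §2 **`exists_mem_opensRange_chartImm_succ_of_one_le_idealOrder`** — COVER: for ANY `IsBlowup π 𝓘Λ`, `p ≤ ord_{(x_S)} F`,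
  every point of `W` at which the controlled transform `σᶜ((z^p + F)·𝒪, p)` has positive order and which lies in the
  `z`-chart lies in the `x_j`-chart for some `j ∈ S`; with the chart cover (`exists_mem_opensRange_chartImm`) every
  point of positive order of `W` lies in some `x_j`-chart, `j ∈ S` (`exists_mem_opensRange_chartImm_succ`);
* §3 **`le_idealOrder_controlledTransform_iff_of_isClosed'`** — SYNTHESIS with TY-3c (`K` algebraically closed): a
  closed point `w` of `W` has `ord_w σᶜ ≥ p` iff `w = chartImm_j (a, b)` for some `j ∈ S` and a rational `(a, b)` with
  `a^p + F′_j(b) = 0` and `CentreBlowup.IsEquimultiplePoint p S j b s` — S3 (b) «POINTS» of the cell's line: every closed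
  point of the new order-`p` locus is an equimultiple point of the model in some chart.

AI-produced formalisation, weaker than expert review. bears_on: LADDER-RESOLUTION:D157-DOOR2 (res-dim4-pi · TY-3e).
-/

set_option linter.dupNamespace false -- D-0017: single-problem summit path `Summit.<S>.<S>.…` by design

noncomputable section

open MvPolynomial Finset CategoryTheory AlgebraicGeometry Opposite
open AlgebraicGeometry.Scheme.IdealSheafData (ofIdealTop)

namespace Summit.ResolutionOfSingularities.ResolutionOfSingularities.Theorems.PIDim4

open Literature.AlgebraicGeometry.Resolution
open Literature.AlgebraicGeometry.Resolution.Hauser2010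
open Literature.AlgebraicGeometry.Resolution.AffinePointBlowup (P A γ coord Wtop)

namespace Equimultiple

/-! ## §1 Chart overlap: `z`-chart points with `x′ⱼ ∉ 𝔭` lie in `W[⊤, x_j]` -/

section Overlap

variable {K : Type} [Field K]
variable {S : Finset (Fin 4)} {W : Scheme.{0}} {π : W ⟶ P 4 K}

/-- `(Spec ψ)^*` at the top open, in coordinates: `(Spec ψ).appLE ⊤ ⊤ _ (γ⁻¹ a) = γ⁻¹ (ψ a)`. [folklore] -/
theorem appLE_top_specMap_γ_symm (ψ : A 4 K →+* A 4 K) (a : A 4 K)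
    (e : (⊤ : (P 4 K).Opens) ≤ Spec.map (CommRingCat.ofHom ψ) ⁻¹ᵁ (⊤ : (P 4 K).Opens)) :
    (Spec.map (CommRingCat.ofHom ψ)).appLE ⊤ ⊤ e ((γ 4 K).symm a) = (γ 4 K).symm (ψ a) := by
  have h : (Spec.map (CommRingCat.ofHom ψ)).appLE ⊤ ⊤ e = (Spec.map (CommRingCat.ofHom ψ)).appTop := by
    change _ = (Spec.map (CommRingCat.ofHom ψ)).app ⊤
    rw [Scheme.Hom.app_eq_appLE]
    rfl
  rw [h]
  exact ChartDictionary.appTop_specMap_γ_symm ψ a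

/-- **Chart overlap.** Let `π : W → 𝔸⁵_K` be a blowing up along `V(z, x_S)`, `φ₀ = chartImm_z` its `z`-chart and
`x` a point of the chart with `xⱼ ∉ 𝔭_x` for some `j ∈ S`. Then `φ₀ x` lies in the principal chart `W[⊤, x_j]`: on the
basic open `D(u)`, `u = x′ⱼ` of the (affine) image of the `z`-chart, `π^*x_j = π^*z · u` with `u` a unit, so it is a
nonzerodivisor generating the exceptional ideal `(π^*z)`. [cite: StacksProject, Tag 0804 (principal charts of a blowing up)] -/
theorem chartImm_zero_mem_chart_succ
    (hπ : IsBlowup π (AffineCoordBlowup.𝓘Λ 4 K (insert 0 (Fin.succ '' (S : Set (Fin 4)))))) {j : Fin 4}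
    (hj : j ∈ S) {x : P 4 K} (hx : (X j.succ : A 4 K) ∉ x.asIdeal) :
    AffineCoordBlowup.chartImm hπ (ChartDictionary.zero_mem_centreVars S) x ∈
      AffineCoordBlowup.chart (insert 0 (Fin.succ '' (S : Set (Fin 4)))) π j.succ := by
  -- notation: the `z`-chart immersion `φ`, its affine image `V₀ = φ(𝔸⁵)`, the sections iso `e`
  set Λ : Set (Fin (4 + 1)) := insert 0 (Fin.succ '' (S : Set (Fin 4))) with hΛ
  have h0 : (0 : Fin (4 + 1)) ∈ Λ := ChartDictionary.zero_mem_centreVars S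
  have hjΛ : j.succ ∈ Λ := ChartDictionary.succ_mem_centreVars hj
  set φ := AffineCoordBlowup.chartImm hπ h0 with hφ
  let V₀ : W.affineOpens := ⟨φ ''ᵁ ⊤, (isAffineOpen_top (P 4 K)).image_of_isOpenImmersion φ⟩
  have hV₀chart : (V₀ : W.Opens) ≤ AffineCoordBlowup.chart Λ π 0 := by
    change φ ''ᵁ ⊤ ≤ _
    rw [← AffineCoordBlowup.opensRange_chartImm hπ h0]
    exact φ.image_le_opensRange ⊤
  have hV₀ : (V₀ : W.Opens) ≤ π ⁻¹ᵁ ((Wtop 4 K) : (P 4 K).Opens) :=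
    hV₀chart.trans (AffineCoordBlowup.chart_le Λ π 0)
  let e : Γ(W, φ ''ᵁ ⊤) ≅ Γ(P 4 K, ⊤) := φ.appIso ⊤
  -- `e (π^* s) = γ⁻¹ (ψ₀ (γ s))`
  have hsq := AffineCoordBlowup.chartImm_comp hπ h0
  have he : ∀ a : A 4 K, e.hom (π.appLE (Wtop 4 K) V₀ hV₀ ((γ 4 K).symm a)) =
      (γ 4 K).symm (coordBlowupSubst K Λ 0 a) := by
    intro a
    change (φ.appIso ⊤).hom _ = _
    rw [Scheme.Hom.appIso_hom', ← CommRingCat.comp_apply, Scheme.Hom.appLE_comp_appLE,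
      appLE_congr_hom hsq]
    exact appLE_top_specMap_γ_symm _ a _
  -- the principal chart structure of `V₀ ⊆ W[⊤, z]` for `(⊤, z)`
  have hPC0 : IsPrincipalChart π (AffineCoordBlowup.𝓘Λ 4 K Λ) (Wtop 4 K) (coord 4 K 0) V₀ :=
    (hπ.isPrincipalChart_blowupChart (AffineCoordBlowup.coord_mem_𝓘Λ 4 K Λ h0)).of_le hV₀chart
  obtain ⟨hV₀', hnzd0, hideal0⟩ := hPC0
  -- the sections `t₀ = π^* z`, `u = x′ⱼ`, `t_j = π^* x_j = t₀ · u` on `V₀`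
  set t₀ : Γ(W, V₀) := π.appLE (Wtop 4 K) V₀ hV₀ (coord 4 K 0) with ht₀
  set u : Γ(W, V₀) := e.inv ((γ 4 K).symm (X j.succ)) with hu
  have htj : π.appLE (Wtop 4 K) V₀ hV₀ (coord 4 K j.succ) = t₀ * u := by
    apply e.commRingCatIsoToRingEquiv.injective
    change e.hom _ = e.hom (t₀ * u)
    rw [map_mul, ht₀, hu, show coord 4 K j.succ = (γ 4 K).symm (X j.succ) from rfl,
      show coord 4 K 0 = (γ 4 K).symm (X 0) from rfl, he, he,
      show e.hom (e.inv ((γ 4 K).symm (X j.succ))) = (γ 4 K).symm (X j.succ) from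
        by rw [← CommRingCat.comp_apply, Iso.inv_hom_id, CommRingCat.id_apply],
      coordBlowupSubst_X_self, coordBlowupSubst_X_of_mem_of_ne K Λ 0 hjΛ (Fin.succ_ne_zero j),
      map_mul]
  -- the basic open `W' = D(u) ⊆ V₀` is a principal chart for `(⊤, x_j)`
  let W' : W.affineOpens := W.affineBasicOpen u
  have hW'V₀ : (W' : W.Opens) ≤ V₀ := W.basicOpen_le u
  have hW' : (W' : W.Opens) ≤ π ⁻¹ᵁ ((Wtop 4 K) : (P 4 K).Opens) := hW'V₀.trans hV₀
  have hres : ∀ s, π.appLE (Wtop 4 K) W' hW' s =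
      W.presheaf.map (homOfLE hW'V₀).op (π.appLE (Wtop 4 K) V₀ hV₀ s) := by
    intro s
    rw [← CommRingCat.comp_apply, Scheme.Hom.appLE_map]
  have hunit : IsUnit (W.presheaf.map (homOfLE hW'V₀).op u) := RingedSpace.isUnit_res_basicOpen _ u
  have hPC : IsPrincipalChart π (AffineCoordBlowup.𝓘Λ 4 K Λ) (Wtop 4 K) (coord 4 K j.succ) W' := by
    refine ⟨hW', ?_, ?_⟩
    · rw [hres, htj, map_mul]
      exact mul_mem (map_mem_nonZeroDivisors_of_le hW'V₀ hnzd0) hunit.mem_nonZeroDivisors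
    · rw [← Scheme.IdealSheafData.map_ideal _ hW'V₀, hideal0, Ideal.map_span, Set.image_singleton, hres, htj,
        map_mul]
      exact (Ideal.span_singleton_mul_right_unit hunit _).symm
  -- and contains `φ x`: `φ⁻¹ D(u) = D(φ^* u) = D(x_j)` since `e u = x_j`
  refine mem_blowupChart_iff.mpr ⟨W', hPC, ?_⟩
  change x ∈ φ ⁻¹ᵁ W.basicOpen u
  have h1 : e.hom u = (γ 4 K).symm (X j.succ) := by
    rw [hu, ← CommRingCat.comp_apply, Iso.inv_hom_id, CommRingCat.id_apply]
  have h2 : (P 4 K).basicOpen (e.hom u) = ⊤ ⊓ φ ⁻¹ᵁ W.basicOpen u := by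
    change (P 4 K).basicOpen ((φ.appIso ⊤).hom u) = _
    rw [Scheme.Hom.appIso_hom', Scheme.basicOpen_appLE]
  rw [top_inf_eq] at h2
  rw [← h2, h1, show (γ 4 K).symm (X j.succ) = (Scheme.ΓSpecIso (.of (A 4 K))).inv (X j.succ) from rfl,
    basicOpen_eq_of_affine]
  exact hx

end Overlap

/-! ## §2 Cover: the points of positive order lie in the `x_j`-charts, `j ∈ S` -/

section Cover

variable {K : Type} [Field K] {p : ℕ} [hp : Fact p.Prime]
variable {S : Finset (Fin 4)} {W : Scheme.{0}} {π : W ⟶ P 4 K}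

/-- **COVER.** For ANY blowing up `π : W → 𝔸⁵_K` along `V(z, x_S)` and `p ≤ ord_{(x_S)} F`: every point of `W` at which
the controlled transform `σᶜ((z^p + F)·𝒪, p)` has positive order lies in the `x_j`-chart for some `j ∈ S` (it lies in
some chart of `Λ_S = {z} ∪ x_S`; if that is the `z`-chart, part 1 gives `j ∈ S` with `x′ⱼ ∉ 𝔭` and §1 moves it to
`W[⊤, x_j]`). [cite: Hauser2010, §F (points of the transform above the centre)] [cite: StacksProject, Tag 0804] -/
theorem exists_mem_opensRange_chartImm_succ_of_one_le_idealOrder (F : MvPolynomial (Fin 4) K)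
    (hperm : (p : ℕ∞) ≤ CentreBlowup.ordAlong S F)
    (hπ : IsBlowup π (AffineCoordBlowup.𝓘Λ 4 K (insert 0 (Fin.succ '' (S : Set (Fin 4)))))) {w : W}
    (hord : 1 ≤ idealOrder (controlledTransform π
      (AffineCoordBlowup.𝓘Λ 4 K (insert 0 (Fin.succ '' (S : Set (Fin 4))))) (hypSheaf p F) p) w) :
    ∃ (j : Fin 4) (hj : j ∈ S),
      w ∈ (AffineCoordBlowup.chartImm hπ (ChartDictionary.succ_mem_centreVars hj)).opensRange := by
  obtain ⟨⟨i, hi⟩, hw⟩ := AffineCoordBlowup.exists_mem_opensRange_chartImm hπ w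
  rcases Set.mem_insert_iff.mp hi with h0 | ⟨j, hj, hji⟩
  · -- the `z`-chart
    subst h0
    obtain ⟨x, rfl⟩ := hw
    obtain ⟨j, hj, hxj⟩ := exists_X_succ_not_mem_of_one_le_idealOrder (p := p) F hperm hπ hord
    refine ⟨j, hj, ?_⟩
    rw [AffineCoordBlowup.opensRange_chartImm]
    exact chartImm_zero_mem_chart_succ hπ hj hxj
  · subst hji
    exact ⟨j, hj, hw⟩

/-- In particular every point of order `≥ p` of the controlled transform lies in an `x_j`-chart, `j ∈ S`.
[cite: Hauser2010, §F (points of the transform above the centre)] -/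
theorem exists_mem_opensRange_chartImm_succ_of_le_idealOrder (F : MvPolynomial (Fin 4) K)
    (hperm : (p : ℕ∞) ≤ CentreBlowup.ordAlong S F)
    (hπ : IsBlowup π (AffineCoordBlowup.𝓘Λ 4 K (insert 0 (Fin.succ '' (S : Set (Fin 4)))))) {w : W}
    (hord : (p : ℕ∞) ≤ idealOrder (controlledTransform π
      (AffineCoordBlowup.𝓘Λ 4 K (insert 0 (Fin.succ '' (S : Set (Fin 4))))) (hypSheaf p F) p) w) :
    ∃ (j : Fin 4) (hj : j ∈ S),
      w ∈ (AffineCoordBlowup.chartImm hπ (ChartDictionary.succ_mem_centreVars hj)).opensRange :=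
  exists_mem_opensRange_chartImm_succ_of_one_le_idealOrder F hperm hπ
    (le_trans (by exact_mod_cast hp.out.one_lt.le) hord)

end Cover

/-! ## §3 Synthesis: the closed order-`p` points of the transform (`K` algebraically closed) -/

section Synthesis

variable {K : Type} [Field K] {p : ℕ} [hp : Fact p.Prime] [CharP K p]
variable {S : Finset (Fin 4)} {W : Scheme.{0}} {π : W ⟶ P 4 K}

/-- **S3 (b) «POINTS» (cell `res-dim4-pi`).** `K` algebraically closed of characteristic `p`, `π : W → 𝔸⁵_K` ANY
blowing up along the Hironaka-permissible coordinate centre `V(z, x_S)` of `z^p + F` (`p ≤ ord_{(x_S)} F`). A CLOSED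
point `w` of `W` is a point of order `≥ p` (= exactly `p`) of the controlled transform `σᶜ((z^p + F)·𝒪, p)` iff it is
the image `chartImm_j (a, b)` of a rational point of some `x_j`-chart, `j ∈ S`, with `a^p + F′_j(b) = 0`
(`F′_j = CentreBlowup.chartTransform p S j F`) and `CentreBlowup.IsEquimultiplePoint p S j b s` — every closed point of
the new order-`p` locus is an equimultiple point of the tree's coordinate-centre walk in some chart.
[cite: Hauser2010, §F (equiconstant points)] [cite: BierstoneGrigorievMilmanWlodarczyk2011, §3.2 and Lemma 8.0.3 (2)] -/
theorem le_idealOrder_controlledTransform_iff_exists_chart [IsAlgClosed K] (s : State K)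
    (hperm : (p : ℕ∞) ≤ CentreBlowup.ordAlong S s.F)
    (hπ : IsBlowup π (AffineCoordBlowup.𝓘Λ 4 K (insert 0 (Fin.succ '' (S : Set (Fin 4)))))) {w : W}
    (hw : IsClosed ({w} : Set W)) :
    (p : ℕ∞) ≤ idealOrder (controlledTransform π
        (AffineCoordBlowup.𝓘Λ 4 K (insert 0 (Fin.succ '' (S : Set (Fin 4))))) (hypSheaf p s.F) p) w ↔
      ∃ (j : Fin 4) (hj : j ∈ S) (x : P 4 K) (a : K) (b : Fin 4 → K),
        AffineCoordBlowup.chartImm hπ (ChartDictionary.succ_mem_centreVars hj) x = w ∧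
          x.asIdeal = MvPolynomial.vanishingIdeal K {(Fin.cons a b : Fin (4 + 1) → K)} ∧
            a ^ p + eval b (CentreBlowup.chartTransform p S j s.F) = 0 ∧
              CentreBlowup.IsEquimultiplePoint p S j b s := by
  constructor
  · intro hord
    obtain ⟨j, hj, hwj⟩ := exists_mem_opensRange_chartImm_succ_of_le_idealOrder (p := p) s.F hperm hπ hord
    obtain ⟨x, a, b, hxw, hx, hab, heq⟩ :=
      (le_idealOrder_controlledTransform_iff_of_isClosed hj s hperm hπ hw hwj).mp hord
    exact ⟨j, hj, x, a, b, hxw, hx, hab, heq⟩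
  · rintro ⟨j, hj, x, a, b, hxw, hx, hab, heq⟩
    exact (le_idealOrder_controlledTransform_iff_of_isClosed hj s hperm hπ hw ⟨x, hxw⟩).mpr
      ⟨x, a, b, hxw, hx, hab, heq⟩

omit hp [CharP K p] in
/-- A point `chartImm_j x` of the `x_j`-chart lies OVER THE CENTRE `V(z, x_S)` iff `xⱼ ∈ 𝔭_x` (the exceptional
divisor of the chart is the hyperplane `x_j = 0`, typ-2's `ChartDictionary.comap_𝓘Λ_chartImm`); for a rational
`x = (a, b)` this is `b_j = 0` (`X_succ_mem_asIdeal_iff`). [cite: HauserPerlega2019PRIMS, §2 (the blowup in the x₁-chart)] -/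
theorem π_chartImm_mem_CΛ_iff (hπ : IsBlowup π (AffineCoordBlowup.𝓘Λ 4 K (insert 0 (Fin.succ '' (S : Set (Fin 4))))))
    {j : Fin 4} (hj : j ∈ S) (x : P 4 K) :
    π (AffineCoordBlowup.chartImm hπ (ChartDictionary.succ_mem_centreVars hj) x) ∈
        AffineCoordBlowup.CΛ 4 K (insert 0 (Fin.succ '' (S : Set (Fin 4)))) ↔
      (X j.succ : A 4 K) ∈ x.asIdeal := by
  have key : x ∈ (((AffineCoordBlowup.𝓘Λ 4 K (insert 0 (Fin.succ '' (S : Set (Fin 4))))).comap π).comap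
      (AffineCoordBlowup.chartImm hπ (ChartDictionary.succ_mem_centreVars hj))).support ↔
      x ∈ (ofIdealTop (Ideal.span {coord 4 K j.succ}) : (P 4 K).IdealSheafData).support := by
    rw [ChartDictionary.comap_𝓘Λ_chartImm hj hπ]
  rw [Scheme.IdealSheafData.support_comap, Scheme.IdealSheafData.support_comap,
    AffineCoordBlowup.support_𝓘Λ] at key
  have hmem : π (AffineCoordBlowup.chartImm hπ (ChartDictionary.succ_mem_centreVars hj) x) ∈
      AffineCoordBlowup.CΛ 4 K (insert 0 (Fin.succ '' (S : Set (Fin 4)))) ↔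
      x ∈ ((AffineCoordBlowup.CΛ 4 K (insert 0 (Fin.succ '' (S : Set (Fin 4))))).preimage π.continuous).preimage
        (AffineCoordBlowup.chartImm hπ (ChartDictionary.succ_mem_centreVars hj)).continuous := Iff.rfl
  rw [hmem, key, ← one_le_idealOrder_iff, show coord 4 K j.succ = (γ 4 K).symm (X j.succ) from rfl,
    one_le_idealOrder_ofIdealTop_span_iff]

end Synthesis

end Equimultiple

end Summit.ResolutionOfSingularities.ResolutionOfSingularities.Theorems.PIDim4

end
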